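import Summits.Schanuel.Schanuel.Theorems.ZilberEacRealSplitLevel
import Summits.Schanuel.Schanuel.Theorems.ZilberEacRealParamCore
import Summits.Schanuel.Schanuel.Theorems.ZilberEacRealSplitDensity
import HarnessLib

/-!
# Real irrational slope × PARAMETRISED plane curve: Zariski dense exponential points (non-graph fibres)

Zilber's Exponential-Algebraic Closedness, case ladder (host summit Schanuel, cell `pub-schanuel`,
seat 2, gen 7).

**THEOREM (`unprojectedDense_lineParam`).**  Let `a ∈ ℝ \ ℚ`, `b ∈ ℂ`, and `q₀, q₁ ∈ ℂ[t]` nonzero,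
not both constant.  Then the exponential points of the surface
`S = {(x, a x + b ; q₀(t), q₁(t)) : x, t ∈ ℂ} ⊆ ℂ² × ℂ²` — the line of slope `a` times the
polynomially PARAMETRISED plane curve `C = {(q₀(t), q₁(t))}` — are Zariski dense in `S`
(`I(S ∩ Γ_exp) = I(S)`); in particular `e^{z} = q₀(t)`, `e^{a z + b} = q₁(t)` is solvable
(`exists_exp_line_param`).  The curve `C` is in general NOT a graph over either coordinate — e.g. the
nodal cubic `t ↦ (t² - 1, t³ - t)`, `{y₁² = y₀²(y₀ + 1)}` (`unprojectedDense_sqrt_two_nodal_cubic`) —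
so this is the first class of NON-GRAPH fibres for which Mantova–Masser's density question
(Proc. LMS 2024, §1 p. 5) is decided in the tree (graph fibres `y₀ = q(y₁)`: `ZilberEacRealLineDensity`
≡ seat 1's `ZilberEacDensityRealSlope`; the general non-graph fibre — an arbitrary irreducible
`C ⊆ (ℂˣ)²` — stays OPEN: it needs a level point on `C`, i.e. that every line of irrational slope meets
the amoeba of `C`).

Method: the parametrised open-mapping engine `ZilberEacRealParamCore.realParam_core` (`s = 1`,
`L(t) = log q₁(t) - a log q₀(t) - b`), a level point from
`ZilberEacRealSplitLevel.exists_zero_weightedLogNorm` (weights `(1, -a)`; the degree condition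
`deg q₁ ≠ a deg q₀` is automatic), and the limit-form elimination
`ZilberEacRealSplitDensity.map_leadingCoeff_eq_zero_of_eval₂_eq_zero` in `ℂ[t][x]`.

**HONEST FRAMING.** Existence is a special case of Gallinaro 2023 Thm 8.8 (`L × W`); density for this
family is not in print.  Nothing here bears on Schanuel's conjecture; `ECCell 3 2` OPEN.
-/

noncomputable section

open MvPolynomial Filter Topology Complex Metric
open Literature.NumberTheory.Transcendental Literature.ModelTheory.Zilber
  Literature.ModelTheory.ExponentialFields

set_option linter.dupNamespace false

namespace Summit.Schanuel.Schanuel.Theorems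

section LineParam

/-- Level point for the parametrised line family: `log |q₁(t)| = a log |q₀(t)| + Re b` with
`q₀(t), q₁(t) ≠ 0`, provided `deg q₁ ≠ a deg q₀`. -/
theorem exists_lineParam_levelPoint (a : ℝ) (b : ℂ) {q₀ q₁ : Polynomial ℂ} (hq₀ : q₀ ≠ 0)
    (hq₁ : q₁ ≠ 0) (hdeg : (q₁.natDegree : ℝ) ≠ a * q₀.natDegree) :
    ∃ t : ℂ, q₁.eval t ≠ 0 ∧ q₀.eval t ≠ 0 ∧
      Real.log ‖q₁.eval t‖ = a * Real.log ‖q₀.eval t‖ + b.re := by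
  have hp : ∀ i : Fin 2, (![q₁, q₀] i) ≠ 0 := fun i => by fin_cases i <;> assumption
  have hd : ∑ i : Fin 2, (![1, -a] i) * (((![q₁, q₀] i)).natDegree : ℝ) ≠ 0 := by
    rw [Fin.sum_univ_two]
    simp only [Matrix.cons_val_zero, Matrix.cons_val_one, one_mul, neg_mul]
    intro h
    apply hdeg
    linarith
  obtain ⟨t, ht, hφ⟩ := exists_zero_weightedLogNorm ![1, -a] (-b.re) hp hd
  refine ⟨t, by simpa using ht 0, by simpa using ht 1, ?_⟩
  rw [Fin.sum_univ_two] at hφ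
  simp only [Matrix.cons_val_zero, Matrix.cons_val_one, one_mul, neg_mul] at hφ
  linarith

/-- For irrational `a` and `q₀, q₁` not both constant, `deg q₁ ≠ a deg q₀`. -/
theorem natDegree_ne_mul_of_irrational {a : ℝ} (ha : Irrational a) {q₀ q₁ : Polynomial ℂ}
    (hnc : 0 < q₀.natDegree ∨ 0 < q₁.natDegree) : (q₁.natDegree : ℝ) ≠ a * q₀.natDegree := by
  intro h
  rcases Nat.eq_zero_or_pos q₀.natDegree with h0 | hpos
  · rw [h0, Nat.cast_zero, mul_zero, Nat.cast_eq_zero] at h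
    rcases hnc with h1 | h1 <;> omega
  · apply ha.ne_rational q₁.natDegree q₀.natDegree
    have hq : (q₀.natDegree : ℝ) ≠ 0 := by exact_mod_cast hpos.ne'
    push_cast
    rw [eq_div_iff hq]
    linarith

/-- **THEOREM (line of real irrational slope × polynomially parametrised curve).**  The exponential
points of `S = {(x, a x + b ; q₀(t), q₁(t))}` are Zariski dense in `S` (`a ∈ ℝ \ ℚ`, `q₀, q₁ ≠ 0` not
both constant). -/
theorem unprojectedDense_lineParam {a : ℝ} (ha : Irrational a) (b : ℂ) {q₀ q₁ : Polynomial ℂ}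
    (hq₀ : q₀ ≠ 0) (hq₁ : q₁ ≠ 0) (hnc : 0 < q₀.natDegree ∨ 0 < q₁.natDegree) :
    UnprojectedDense {z : Fin 2 ⊕ Fin 2 → ℂ |
      ∃ x t : ℂ, z = Sum.elim ![x, (a : ℂ) * x + b] ![q₀.eval t, q₁.eval t]} := by
  classical
  set S : Set (Fin 2 ⊕ Fin 2 → ℂ) := {z | ∃ x t : ℂ,
    z = Sum.elim ![x, (a : ℂ) * x + b] ![q₀.eval t, q₁.eval t]} with hS
  set pt : ℂ → ℂ → Fin 2 ⊕ Fin 2 → ℂ := fun x t =>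
    Sum.elim ![x, (a : ℂ) * x + b] ![q₀.eval t, q₁.eval t] with hpt
  have hptS : ∀ x t, pt x t ∈ S := fun x t => ⟨x, t, rfl⟩
  have hptΓ : ∀ x t, exp x = q₀.eval t → exp ((a : ℂ) * x + b) = q₁.eval t → pt x t ∈ expGraph ℂ 2 := by
    intro x t h0 h1
    rw [mem_expGraph_iff]
    intro i
    fin_cases i <;> simp [hpt, ExponentialRing.complex_exp_eq, h0, h1]
  -- pull-back to `ℂ[t][x]`
  set CC : ℂ →+* Polynomial (Polynomial ℂ) := Polynomial.C.comp Polynomial.C with hCC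
  set σ : Fin 2 ⊕ Fin 2 → Polynomial (Polynomial ℂ) :=
    Sum.elim ![Polynomial.X, CC (a : ℂ) * Polynomial.X + CC b]
      ![Polynomial.C q₀, Polynomial.C q₁] with hσ
  have hevC : ∀ t x, (mmEval t x).comp CC = RingHom.id ℂ := by
    intro t x
    ext c
    simp [hCC, mmEval]
  have hevσ : ∀ t x, (fun i => mmEval t x (σ i)) = pt x t := by
    intro t x
    funext i
    rcases i with i | i <;> fin_cases i <;> simp [hσ, hpt, hCC, mmEval]
  refine le_antisymm ?_ (vanishingIdeal_anti_mono Set.inter_subset_left)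
  intro F hF
  set G : Polynomial (Polynomial ℂ) := MvPolynomial.eval₂Hom CC σ F with hG
  have hGeval : ∀ t x, mmEval t x G = MvPolynomial.eval (pt x t) F := by
    intro t x
    have h1 := DFunLike.congr_fun (MvPolynomial.comp_eval₂Hom CC σ (mmEval t x)) F
    rw [RingHom.comp_apply, hevC, hevσ] at h1
    rw [hG, h1]
    rfl
  -- the engine: level point, then sequences of exponential points
  have hdeg : (q₁.natDegree : ℝ) ≠ ∑ j : Fin 1, (![a] j) * (((![q₀] j)).natDegree : ℝ) := by
    simpa using natDegree_ne_mul_of_irrational ha hnc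
  obtain ⟨t₀, ht₁, ht₀, hlev⟩ := exists_lineParam_levelPoint a b hq₀ hq₁
    (natDegree_ne_mul_of_irrational ha hnc)
  obtain ⟨A, Λ, hA, hcore⟩ := realParam_core ![a] (j₀ := 0) (by simpa using ha) b
    (q := ![q₀]) (p₀ := q₁) hdeg ht₁ (fun j => by fin_cases j; simpa using ht₀) (by simpa using hlev)
  have hG0 : G = 0 := by
    by_contra hGne
    have hlc : G.leadingCoeff ≠ 0 := Polynomial.leadingCoeff_ne_zero.2 hGne
    refine hlc (Polynomial.eq_zero_of_infinite_isRoot _ (hA.mono fun α hα => ?_))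
    obtain ⟨x, w, hx0, hw, -, hpts⟩ := hcore α hα 0
    have h1 := map_leadingCoeff_eq_zero_of_eval₂_eq_zero G
      (fun n => Polynomial.evalRingHom (w n)) (Polynomial.evalRingHom α)
      (fun P => by
        simpa only [Polynomial.coe_evalRingHom, Function.comp_def] using
          (P.continuous.tendsto α).comp hw)
      (fun n => x n 0) hx0 (fun n => ?_)
    · exact Polynomial.IsRoot.def.2 (by simpa only [Polynomial.coe_evalRingHom] using h1)
    · have h2 := hGeval (w n) (x n 0)
      rw [mmEval_eq_eval₂] at h2
      rw [h2]
      refine eval_eq_zero_of_mem_vanishingIdeal hF ⟨hptS _ _, hptΓ _ _ ((hpts n).1 0) ?_⟩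
      have := (hpts n).2
      simpa using this
  refine mem_vanishingIdeal_of_eval fun s hs => ?_
  obtain ⟨x, t, rfl⟩ := hs
  have h := hGeval t x
  rw [hG0, map_zero] at h
  exact h.symm

/-- **Existence**: `e^{z} = q₀(t)`, `e^{a z + b} = q₁(t)` is solvable (`a ∈ ℝ \ ℚ`, `q₀, q₁ ≠ 0` not both
constant). -/
theorem exists_exp_line_param {a : ℝ} (ha : Irrational a) (b : ℂ) {q₀ q₁ : Polynomial ℂ}
    (hq₀ : q₀ ≠ 0) (hq₁ : q₁ ≠ 0) (hnc : 0 < q₀.natDegree ∨ 0 < q₁.natDegree) :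
    ∃ z t : ℂ, exp z = q₀.eval t ∧ exp ((a : ℂ) * z + b) = q₁.eval t := by
  obtain ⟨t₀, ht₁, ht₀, hlev⟩ := exists_lineParam_levelPoint a b hq₀ hq₁
    (natDegree_ne_mul_of_irrational ha hnc)
  have hdeg : (q₁.natDegree : ℝ) ≠ ∑ j : Fin 1, (![a] j) * (((![q₀] j)).natDegree : ℝ) := by
    simpa using natDegree_ne_mul_of_irrational ha hnc
  obtain ⟨A, Λ, hA, hcore⟩ := realParam_core ![a] (j₀ := 0) (by simpa using ha) b
    (q := ![q₀]) (p₀ := q₁) hdeg ht₁ (fun j => by fin_cases j; simpa using ht₀) (by simpa using hlev)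
  obtain ⟨α, hα⟩ := hA.nonempty
  obtain ⟨x, w, -, -, -, hpts⟩ := hcore α hα 0
  refine ⟨x 0 0, w 0, (hpts 0).1 0, ?_⟩
  have := (hpts 0).2
  simpa using this

/-- **The nodal cubic over the slope `√2`**: the exponential points of
`L_{√2} × {y₁² = y₀²(y₀ + 1)}` — parametrised `t ↦ (t² - 1, t³ - t)`, a curve that is a graph over
neither coordinate — are Zariski dense: solutions of `e^{z} = t² - 1`, `e^{√2 z} = t³ - t`. -/
theorem unprojectedDense_sqrt_two_nodal_cubic :
    UnprojectedDense {z : Fin 2 ⊕ Fin 2 → ℂ | ∃ x t : ℂ, z = Sum.elim ![x, (Real.sqrt 2 : ℂ) * x + 0]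
      ![(Polynomial.X ^ 2 - Polynomial.C 1 : Polynomial ℂ).eval t,
        (Polynomial.X ^ 3 - Polynomial.X : Polynomial ℂ).eval t]} := by
  refine unprojectedDense_lineParam irrational_sqrt_two 0 ?_ ?_ (Or.inl ?_)
  · intro h
    have := congrArg (Polynomial.eval (0 : ℂ)) h
    norm_num at this
  · intro h
    have := congrArg (Polynomial.eval (2 : ℂ)) h
    norm_num at this
  · rw [sub_eq_add_neg, ← Polynomial.C_neg, Polynomial.natDegree_X_pow_add_C]
    norm_num

/-- The nodal-cubic system `e^{z} = t² - 1`, `e^{√2 z} = t³ - t` is solvable. -/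
theorem sqrt_two_nodal_cubic_system_solvable :
    ∃ z t : ℂ, exp z = t ^ 2 - 1 ∧ exp ((Real.sqrt 2 : ℂ) * z) = t ^ 3 - t := by
  obtain ⟨z, t, h0, h1⟩ := exists_exp_line_param irrational_sqrt_two 0
    (q₀ := Polynomial.X ^ 2 - Polynomial.C 1) (q₁ := Polynomial.X ^ 3 - Polynomial.X)
    (by
      intro h
      have := congrArg (Polynomial.eval (0 : ℂ)) h
      norm_num at this)
    (by
      intro h
      have := congrArg (Polynomial.eval (2 : ℂ)) h
      norm_num at this)
    (Or.inl (by
      rw [sub_eq_add_neg, ← Polynomial.C_neg, Polynomial.natDegree_X_pow_add_C]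
      norm_num))
  refine ⟨z, t, by simpa using h0, ?_⟩
  simpa using h1

end LineParam

end Summit.Schanuel.Schanuel.Theorems

end
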